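import Literature.NumberTheory.EllipticCurves.GrossPointsThetaNormCompatible
import Literature.NumberTheory.EllipticCurves.GrossPointsThetaElementSupersingular
import Literature.NumberTheory.EllipticCurves.QuadOrderPicardFinite
import HarnessLib

/-!
# Darmon–Iovita 2008, Lemma 2.6 for the tree's `L̃_n` (the `a_p`-norm relation of the UNREGULARISED theta
# elements of a tower of Gross points), and the mod-`p` propagation `p ∣ L̃_{n+2} ⇒ p ∣ L̃_n` at `p ∣ a_p`

Route-independent `Theorems` file (cell `b2b-bsdres`, seat `b2b-bsdres-x10b` = class owner X6/X7, gen 43); part 1 of the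
series «defmu / supersingular theta elements» serving crux 2 `KobayashiLowerHalfSemistable` (stmt-BirchSwinnertonDyer-19000,
line «defmu»: its cite stub `stub_publishedInputs` carries the μ-input `pollackWeston2011_thm_2_5_hasMuZeroLAc`, Pollack–Weston
2011 Thm. 2.5 (i), whose carrier is the tree's `GrossPointTower.lTilde` / `GrossPointTower.lAc`).
HONEST FRAMING: prove what is provable now; shrink each hard class to its core with data; no claim beyond stated classes.
Nothing about any curve is asserted and NO summit statement is proved here; BSD is not proved by any of this.

What IS proved (the module docstring of `Literature/…/GrossPointsThetaElementSupersingular.lean` lists it under "NOT vendored: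
DI Lemma 2.6 / (8) (the `a_p = 0` norm relation; it would be the supersingular twin of the fact `grossPointTower_isNormCompatible`)"):

* `coeff_groupRingProj` — the coefficient of the projection `ℤ_p[G̃_{n+2}] → ℤ_p[G̃_{n+1}]` is the fibre sum.
* `groupRingProj_lTilde` — **Darmon–Iovita, Lemma 2.6**: for a tower `(x_n)` of Gross points on the definite Shimura set of
  a Brandt setup `S` of level `N⁺N⁻`, `p ∤ N⁺N⁻`, `K` imaginary quadratic, and an eigenvector `T(p)φ = aφ` of the Brandt matrix,
  `π_{n+2,n+1}(L̃_{n+2}) = a · L̃_{n+1} − ξ̃ L̃_n` in `ℤ_p[G̃_{n+1}]`, where `ξ̃ L̃_n` is `L̃_n` pulled back along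
  `G̃_{n+1} → G̃_n` (DI: "`ξ̃_{n−1}L̃_{n−1}` viewed in `ℤ_p[G̃_n]`"). Coefficientwise (`coeff_groupRingProj_lTilde`):
  `Σ_{σ ↦ τ} y_{n+2}(σ) = a·y_{n+1}(τ) − y_n(τ̄)` — the tree's norm relation `GrossPointTowerNorm.norm_relation`
  (Bertolini–Darmon 1996 §2.4 (5)) read in the group ring; no unit root, so valid at EVERY `p ∤ N⁺N⁻` (ordinary or not).
* `dvd_coeff_lTilde_of_dvd_coeff_lTilde_add_two` — **mod-`p` propagation two levels DOWN** when `p ∣ a` (in particular at a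
  supersingular prime, `a = a_p(E) = 0`): if every coefficient of `L̃_{n+2}` is divisible by `p` then so is every coefficient
  of `L̃_n`; contrapositively (`exists_not_dvd_coeff_lTilde_add_two`) a unit coefficient of `L̃_n` forces one of `L̃_{n+2}`,
  hence of `L̃_{n+2k}` (`exists_not_dvd_coeff_lTilde_add_two_mul`): "`μ(L̃_n) = 0`" PROPAGATES UP THE TOWER WITHIN A PARITY
  CLASS. (The anticyclotomic elements `L_n ∈ ℤ_p[G̃_{n+1}/Δ]` of DI (8) / PW Thm. 2.5 are treated in the sequel, which needs
  the structure of the image of `Δ` in the finite layers.)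

## References

* [DarmonIovita2008] H. Darmon, A. Iovita, *The anticyclotomic Main Conjecture for elliptic curves at supersingular primes*,
  J. Inst. Math. Jussieu 7 (2008) 291–325, §2.2 Lemma 2.6 and (8).
* [BertoliniDarmon1996] M. Bertolini, H. Darmon, *Heegner points on Mumford–Tate curves*, Invent. Math. 126 (1996), §2.4 (5).
* [PollackWeston2011] R. Pollack, T. Weston, *On anticyclotomic μ-invariants of modular forms*, Compos. Math. 147 (2011),
  §2.4, proof of Thm. 2.5.
-/

noncomputable section

open scoped BigOperators Matrix

-- D-0017: single-problem summit, the namespace repeats the problem name by design.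
set_option linter.dupNamespace false

namespace Summit.BirchSwinnertonDyer.BirchSwinnertonDyer.Theorems.DefmuSupersingularTheta

open Literature.NumberTheory.EllipticCurves Literature.NumberTheory.EllipticCurves.QuadOrderTower
  Literature.NumberTheory.EllipticCurves.GrossPointTowerNorm Literature.NumberTheory.Automorphic
  Literature.NumberTheory.QuadraticFields.Quadratic NumberField

universe u

variable {K : Type u} [Field K] [NumberField K] (p : ℕ) [hp : Fact p.Prime]
  {Nplus Nminus : ℕ} {S : Brandt.XiSetup Nplus Nminus}

/-! ### §1 The pull-back `ℤ_p[G̃_n] → ℤ_p[G̃_{n+1}]` and the coefficients of the projection -/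

omit [NumberField K] in
/-- The coefficient of `Σ_σ single σ (c σ)` at `τ` is `c τ`. [folklore] -/
private theorem coeff_sum_single {G : Type*} [CommGroup G] [Fintype G] (c : G → ℤ_[p]) (τ : G) :
    (∑ σ, MonoidAlgebra.single σ (c σ) : MonoidAlgebra ℤ_[p] G).coeff τ = c τ := by
  classical
  rw [MonoidAlgebra.coeff_sum, Finsupp.finsetSum_apply,
    Finset.sum_eq_single_of_mem τ (Finset.mem_univ _) fun σ _ hσ => ?_]
  · rw [MonoidAlgebra.coeff_single, Finsupp.single_eq_same]
  · rw [MonoidAlgebra.coeff_single, Finsupp.single_eq_of_ne (Ne.symm hσ)]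

omit [NumberField K] in
/-- **Coefficients of the projection `ℤ_p[G̃_{n+2}] → ℤ_p[G̃_{n+1}]`**: `(π x)(τ) = Σ_{σ ↦ τ} x(σ)` (the fibre sum).
[folklore] -/
theorem coeff_groupRingProj (n : ℕ) [Fintype (ClassGroup (quadOrder K (p ^ (n + 2))))]
    [DecidableEq (ClassGroup (quadOrder K (p ^ (n + 1))))]
    (x : MonoidAlgebra ℤ_[p] (ClassGroup (quadOrder K (p ^ (n + 2)))))
    (τ : ClassGroup (quadOrder K (p ^ (n + 1)))) :
    (groupRingProj K p n x).coeff τ =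
      ∑ σ ∈ Finset.univ.filter (fun σ => picRes K (pow_dvd_pow p (n + 1).le_succ) σ = τ), x.coeff σ := by
  classical
  change (MonoidAlgebra.mapDomain (picRes K (pow_dvd_pow p (n + 1).le_succ)) x).coeff τ = _
  rw [MonoidAlgebra.mapDomain, MonoidAlgebra.coeff_ofCoeff, Finsupp.mapDomain, Finsupp.sum_fintype _ _
    (fun _ => Finsupp.single_zero _), Finsupp.finsetSum_apply, Finset.sum_filter]
  refine Finset.sum_congr rfl fun σ _ => ?_
  rw [Finsupp.single_apply]

/-! ### §2 Darmon–Iovita, Lemma 2.6: `π(L̃_{n+2}) = a · L̃_{n+1} − ξ̃ L̃_n` -/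

/-- **Darmon–Iovita 2008, Lemma 2.6, coefficientwise**: for a tower of Gross points of a Brandt setup of level
`N⁺N⁻` with `p ∤ N⁺N⁻` over an imaginary quadratic `K`, and `T(p)φ = aφ`, the fibre sums of the values
`y_{n+2}(σ) = ⟨σ x_{n+2}, φ⟩` over `G̃_{n+2} → G̃_{n+1}` are `Σ_{σ ↦ τ} y_{n+2}(σ) = a·y_{n+1}(τ) − y_n(τ̄)`; in
the group rings: `(π L̃_{n+2})(τ) = a·L̃_{n+1}(τ) − L̃_n(τ̄)`. This is BD96 §2.4 (5) (`GrossPointTowerNorm.norm_relation`,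
Eichler's `p + 1` neighbours) — valid at every `p ∤ N⁺N⁻`, ordinary or supersingular.
[cite: DarmonIovita2008, §2.2 Lemma 2.6] [cite: BertoliniDarmon1996, §2.4 (5)] -/
theorem coeff_groupRingProj_lTilde [Fintype (Brandt.ClassSet S.O)] (hK : IsImaginaryQuadratic K)
    (hpN : ¬ p ∣ Nplus * Nminus) (φ : Brandt.ClassSet S.O → ℤ) (a : ℤ)
    (hφ : Brandt.matrix S.O p *ᵥ φ = a • φ) (T : GrossPointTower K S p) (n : ℕ)
    [Fintype (ClassGroup (quadOrder K (p ^ (n + 2))))] [Fintype (ClassGroup (quadOrder K (p ^ (n + 1))))]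
    [Fintype (ClassGroup (quadOrder K (p ^ n)))] (τ : ClassGroup (quadOrder K (p ^ (n + 1)))) :
    (groupRingProj K p n (T.lTilde p φ (n + 2))).coeff τ =
      (a : ℤ_[p]) * (T.lTilde p φ (n + 1)).coeff τ -
        (T.lTilde p φ n).coeff (picRes K (pow_dvd_pow p n.le_succ) τ) := by
  classical
  obtain ⟨b, hb⟩ := exists_basis_zero_eq_one (K := K) hK.1
  have hc : p ^ (n + 1) = p ^ n * p := pow_succ p n
  have hd : p ^ (n + 2) = p ^ (n + 1) * p := pow_succ p (n + 1)
  have hpc : p ∣ p ^ (n + 1) := dvd_pow_self p n.succ_ne_zero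
  -- a lift `σ₀` of `τ⁻¹`
  obtain ⟨σ₀, hσ₀⟩ := picRes_surjective (K := K) hK.1 hpc hd τ⁻¹
  have hNR := norm_relation hb hK HeegnerStable_holds hpN hpc hc hd φ a hφ (T.mem_grossPoints (n + 2))
    (T.mem_grossPoints (n + 1)) (T.mem_grossPoints n) (T.isPNeighbour (n + 1)) (T.isPNeighbour n) σ₀
  rw [coeff_groupRingProj, GrossPointTower.coeff_lTilde, GrossPointTower.coeff_lTilde]
  simp only [GrossPointTower.coeff_lTilde]
  -- reindex the fibre over `τ` by `σ ↦ σ⁻¹` onto the fibre over `τ⁻¹ = picRes σ₀`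
  have hreindex : ∑ σ ∈ Finset.univ.filter (fun σ => picRes K (pow_dvd_pow p (n + 1).le_succ) σ = τ),
      ((T.y p φ (n + 2) σ⁻¹ : ℤ) : ℤ_[p]) =
      ∑ σ ∈ Finset.univ.filter (fun σ => picRes K (Dvd.intro p hd.symm) σ = picRes K (Dvd.intro p hd.symm) σ₀),
        ((T.y p φ (n + 2) σ : ℤ) : ℤ_[p]) := by
    refine Finset.sum_bij' (fun σ _ => σ⁻¹) (fun σ _ => σ⁻¹) (fun σ hσ => ?_) (fun σ hσ => ?_)
      (fun σ _ => inv_inv σ) (fun σ _ => inv_inv σ) (fun σ _ => rfl)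
    · simp only [Finset.mem_filter, Finset.mem_univ, true_and] at hσ ⊢
      rw [map_inv, hσ₀, hσ]
    · simp only [Finset.mem_filter, Finset.mem_univ, true_and] at hσ ⊢
      rw [map_inv, hσ, hσ₀, inv_inv]
  rw [hreindex]
  simp only [GrossPointTower.y]
  rw [← Int.cast_sum, hNR, hσ₀, map_inv]
  push_cast
  ring

/-- **Darmon–Iovita 2008, Lemma 2.6** ("`π_{n+1,n}(L̃_{n+1}) = a_p(E) L̃_n − ξ̃_{n−1} L̃_{n−1}`"), in the group ring
`ℤ_p[G̃_{n+1}]` and in the tree's indexing: `π(L̃_{n+2}) = a · L̃_{n+1} − ξ̃ L̃_n` for every `n ≥ 0`, `T(p)φ = aφ`, where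
`ξ̃ L̃_n = Σ_σ L̃_n(σ̄) σ` is `L̃_n` pulled back along `G̃_{n+1} → G̃_n` (DI: "`ξ̃_{n−1}L̃_{n−1}` viewed in `ℤ_p[G̃_n]`",
i.e. `ξ̃_{n−1}` times any lift). [cite: DarmonIovita2008, §2.2 Lemma 2.6] [cite: BertoliniDarmon1996, §2.4 (5)] -/
theorem groupRingProj_lTilde [Fintype (Brandt.ClassSet S.O)] (hK : IsImaginaryQuadratic K)
    (hpN : ¬ p ∣ Nplus * Nminus) (φ : Brandt.ClassSet S.O → ℤ) (a : ℤ)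
    (hφ : Brandt.matrix S.O p *ᵥ φ = a • φ) (T : GrossPointTower K S p) (n : ℕ)
    [Fintype (ClassGroup (quadOrder K (p ^ (n + 1))))] :
    groupRingProj K p n (T.lTilde p φ (n + 2)) =
      (a : ℤ_[p]) • T.lTilde p φ (n + 1) -
        ∑ σ, MonoidAlgebra.single σ ((T.lTilde p φ n).coeff (picRes K (pow_dvd_pow p n.le_succ) σ)) := by
  haveI := @Fintype.ofFinite (ClassGroup (quadOrder K (p ^ (n + 2)))) (finite_classGroup (K := K) _)
  haveI := @Fintype.ofFinite (ClassGroup (quadOrder K (p ^ n))) (finite_classGroup (K := K) _)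
  refine MonoidAlgebra.ext (Finsupp.ext fun τ => ?_)
  rw [coeff_groupRingProj_lTilde p hK hpN φ a hφ T n τ, MonoidAlgebra.coeff_sub, Finsupp.sub_apply,
    MonoidAlgebra.coeff_smul, Finsupp.smul_apply, smul_eq_mul, coeff_sum_single]

/-! ### §3 `p ∣ a`: divisibility of all coefficients propagates two levels DOWN, a unit coefficient two levels UP -/

/-- **Mod-`p` propagation (supersingular case `p ∣ a`, e.g. `a = a_p(E) = 0`)**: if every coefficient of `L̃_{n+2}`
is divisible by `p`, so is every coefficient of `L̃_n` — each `L̃_n(τ̄) = a·L̃_{n+1}(τ) − Σ_{σ ↦ τ} L̃_{n+2}`-coefficient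
sum, and every class of `G̃_n` is a `τ̄` (`n ≥ 1`: `picRes_surjective`; at `n = 0` the hypothesis `hsurj` is the
surjectivity of `Pic(𝒪_p) → Pic(𝓞_K)`, supplied by the caller). Stated for the levels `n + 1 ≥ 1` where the
restriction `G̃_{n+2} → G̃_{n+1}` is onto unconditionally. [cite: DarmonIovita2008, §2.2 Lemma 2.6 and (8)]
[cite: PollackWeston2011, §2.4, proof of Thm. 2.5] -/
theorem dvd_coeff_lTilde_of_dvd_coeff_lTilde_add_two [Fintype (Brandt.ClassSet S.O)] (hK : IsImaginaryQuadratic K)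
    (hpN : ¬ p ∣ Nplus * Nminus) (φ : Brandt.ClassSet S.O → ℤ) (a : ℤ)
    (hφ : Brandt.matrix S.O p *ᵥ φ = a • φ) (hpa : (p : ℤ) ∣ a) (T : GrossPointTower K S p) (n : ℕ)
    (h : ∀ g, (p : ℤ_[p]) ∣ (T.lTilde p φ (n + 3)).coeff g) :
    ∀ g, (p : ℤ_[p]) ∣ (T.lTilde p φ (n + 1)).coeff g := by
  classical
  haveI := @Fintype.ofFinite (ClassGroup (quadOrder K (p ^ (n + 3)))) (finite_classGroup (K := K) _)
  haveI := @Fintype.ofFinite (ClassGroup (quadOrder K (p ^ (n + 2)))) (finite_classGroup (K := K) _)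
  haveI := @Fintype.ofFinite (ClassGroup (quadOrder K (p ^ (n + 1)))) (finite_classGroup (K := K) _)
  intro g
  have hd : p ^ (n + 2) = p ^ (n + 1) * p := pow_succ p (n + 1)
  have hpc : p ∣ p ^ (n + 1) := dvd_pow_self p n.succ_ne_zero
  obtain ⟨τ, hτ⟩ := picRes_surjective (K := K) hK.1 hpc hd g
  have key : (groupRingProj K p (n + 1) (T.lTilde p φ (n + 3))).coeff τ =
      (a : ℤ_[p]) * (T.lTilde p φ (n + 2)).coeff τ -
        (T.lTilde p φ (n + 1)).coeff (picRes K (pow_dvd_pow p (n + 1).le_succ) τ) :=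
    coeff_groupRingProj_lTilde p hK hpN φ a hφ T (n + 1) τ
  have hτ' : picRes K (pow_dvd_pow p (n + 1).le_succ) τ = g := hτ
  rw [hτ', coeff_groupRingProj] at key
  -- `L̃_{n+1}(g) = a L̃_{n+2}(τ) − Σ_fibre L̃_{n+3}`
  have e : (T.lTilde p φ (n + 1)).coeff g =
      (a : ℤ_[p]) * (T.lTilde p φ (n + 2)).coeff τ -
        ∑ σ ∈ Finset.univ.filter (fun σ => picRes K (pow_dvd_pow p (n + 2).le_succ) σ = τ),
          (T.lTilde p φ (n + 3)).coeff σ := by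
    linear_combination key
  rw [e]
  refine dvd_sub (Dvd.dvd.mul_right ?_ _) (Finset.dvd_sum fun σ _ => h σ)
  obtain ⟨k, hk⟩ := hpa
  exact ⟨(k : ℤ_[p]), by rw [hk]; push_cast; ring⟩

/-- Contrapositive: **a unit coefficient of `L̃_{n+1}` forces a unit coefficient of `L̃_{n+3}`** (`p ∣ a`). In `ℤ_p`
"not divisible by `p`" is "unit". [cite: DarmonIovita2008, §2.2 Lemma 2.6 and (8)] [cite: PollackWeston2011, §2.4, proof of Thm. 2.5] -/
theorem exists_not_dvd_coeff_lTilde_add_two [Fintype (Brandt.ClassSet S.O)] (hK : IsImaginaryQuadratic K)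
    (hpN : ¬ p ∣ Nplus * Nminus) (φ : Brandt.ClassSet S.O → ℤ) (a : ℤ)
    (hφ : Brandt.matrix S.O p *ᵥ φ = a • φ) (hpa : (p : ℤ) ∣ a) (T : GrossPointTower K S p) (n : ℕ)
    (h : ∃ g, ¬ (p : ℤ_[p]) ∣ (T.lTilde p φ (n + 1)).coeff g) :
    ∃ g, ¬ (p : ℤ_[p]) ∣ (T.lTilde p φ (n + 3)).coeff g := by
  by_contra hcon
  push Not at hcon
  obtain ⟨g, hg⟩ := h
  exact hg (dvd_coeff_lTilde_of_dvd_coeff_lTilde_add_two p hK hpN φ a hφ hpa T n hcon g)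

/-- **Propagation within a parity class**: a unit coefficient of `L̃_{n+1}` forces one of `L̃_{n+1+2k}` for every `k`
(`p ∣ a`). So "`μ(L̃_m) = 0` for all large `m`" holds as soon as it holds at ONE odd and ONE even level `≥ 1`.
[cite: DarmonIovita2008, §2.2 Lemma 2.6 and (8)] [cite: PollackWeston2011, §2.4, proof of Thm. 2.5] -/
theorem exists_not_dvd_coeff_lTilde_add_two_mul [Fintype (Brandt.ClassSet S.O)] (hK : IsImaginaryQuadratic K)
    (hpN : ¬ p ∣ Nplus * Nminus) (φ : Brandt.ClassSet S.O → ℤ) (a : ℤ)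
    (hφ : Brandt.matrix S.O p *ᵥ φ = a • φ) (hpa : (p : ℤ) ∣ a) (T : GrossPointTower K S p) (n : ℕ)
    (h : ∃ g, ¬ (p : ℤ_[p]) ∣ (T.lTilde p φ (n + 1)).coeff g) (k : ℕ) :
    ∃ g, ¬ (p : ℤ_[p]) ∣ (T.lTilde p φ (n + 1 + 2 * k)).coeff g := by
  induction k with
  | zero => simpa using h
  | succ k ih =>
    have e : n + 1 + 2 * (k + 1) = (n + 2 * k) + 3 := by ring
    rw [e]
    exact exists_not_dvd_coeff_lTilde_add_two p hK hpN φ a hφ hpa T (n + 2 * k) (by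
      have e' : n + 2 * k + 1 = n + 1 + 2 * k := by ring
      rw [e']; exact ih)

/-- In `ℤ_p`, a coefficient is a unit iff it is not divisible by `p`; so the propagation reads on PW's "`μ = 0`"
(`∃ g, IsUnit (L̃_m.coeff g)`). [folklore] -/
theorem isUnit_iff_not_dvd (x : ℤ_[p]) : IsUnit x ↔ ¬ (p : ℤ_[p]) ∣ x := by
  rw [← PadicInt.norm_lt_one_iff_dvd, not_lt]
  constructor
  · intro h
    exact (PadicInt.isUnit_iff.mp h).ge
  · intro h
    exact PadicInt.isUnit_iff.mpr (le_antisymm (PadicInt.norm_le_one x) h)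

/-- **`μ(L̃_{n+1}) = 0 ⇒ μ(L̃_{n+1+2k}) = 0`** in Pollack–Weston's wording (a unit coefficient), `p ∣ a`.
[cite: PollackWeston2011, §2.4, proof of Thm. 2.5] [cite: DarmonIovita2008, §2.2 Lemma 2.6 and (8)] -/
theorem exists_isUnit_coeff_lTilde_add_two_mul [Fintype (Brandt.ClassSet S.O)] (hK : IsImaginaryQuadratic K)
    (hpN : ¬ p ∣ Nplus * Nminus) (φ : Brandt.ClassSet S.O → ℤ) (a : ℤ)
    (hφ : Brandt.matrix S.O p *ᵥ φ = a • φ) (hpa : (p : ℤ) ∣ a) (T : GrossPointTower K S p) (n : ℕ)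
    (h : ∃ g, IsUnit ((T.lTilde p φ (n + 1)).coeff g)) (k : ℕ) :
    ∃ g, IsUnit ((T.lTilde p φ (n + 1 + 2 * k)).coeff g) := by
  simp only [isUnit_iff_not_dvd] at h ⊢
  exact exists_not_dvd_coeff_lTilde_add_two_mul p hK hpN φ a hφ hpa T n h k

end Summit.BirchSwinnertonDyer.BirchSwinnertonDyer.Theorems.DefmuSupersingularTheta

end
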